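import Summits.CriticalPhenomena.CardyFormulaZ2.Theorems.StripClusterRates.Negative.KacFromAboveFalse
import Literature.Probability.Percolation.HalfSpaceBrickUp
import Literature.Probability.Percolation.RSWLemma

/-!
# `StripClusterRates` (stmt-CriticalPhenomena-13878): the width-1 two-cluster rate is EXACTLY
# `γ₂(1) = 3 log 2` — the bound `rateTwo_le` is attained

Negative/tightness lemma for the crux `StripClusterRates` (cdisprove unit, cycle 2). In the two-row
strip `[0,m]×[0,1]` two open left–right crossings lying in distinct open clusters of the rectangle
are forced to be the two full rows with every rung closed (`twoClusterEvent_width_one_subset`):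
each column `{(i,0),(i,1)}` is visited by both crossings, at distinct vertices (a shared vertex or
an open rung would merge the clusters), and between consecutive columns the only passages are the
two horizontal edges, one per crossing. Hence `p₂(m,1) = 2^{-(3m+1)}` exactly (`pTwo_width_one`),
`-log p₂(m,1)/m = (3m+1) log 2/m` and `γ₂(1) = 3 log 2` (`rateTwo_width_one`,
`rateTwo_width_one_unique`): the explicit-configuration bound `γ₂(n) ≤ 3 log 2` of
`KacFromAboveFalse` cannot be improved uniformly in `n`, and `1·γ₂(1) = 2.0794… < 2π`.
-/

noncomputable section

open MeasureTheory Filter Topology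
open Literature.Probability.LatticeModels Literature.Probability.Percolation

namespace Summit.CriticalPhenomena.CardyFormulaZ2.Theorems.StripClusterRates.Negative

open Summit.CriticalPhenomena.CardyFormulaZ2.Theses.CardyBoundaryCoulombGas (StripClusterRates)

/-! ## §1 Lattice-walk bookkeeping -/

/-- A lattice walk from column `≤ i` to column `≥ i + 1` contains a step from column `i` to column
`i + 1`, which is horizontal. [folklore] -/
theorem exists_step_across {u v : Site 2} (P : (zdGraph 2).Walk u v) (i : ℤ) (hu : u 0 ≤ i)
    (hv : i + 1 ≤ v 0) :
    ∃ a b : Site 2, a ∈ P.support ∧ b ∈ P.support ∧ s(a, b) ∈ P.edges ∧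
      a 0 = i ∧ b 0 = i + 1 ∧ b 1 = a 1 := by
  induction P with
  | nil => omega
  | cons hadj P ih =>
    rename_i u w v
    have hcases := (zdGraph_two_adj_iff u w).1 hadj
    by_cases h : u 0 = i ∧ w 0 = i + 1
    · refine ⟨u, w, by simp, by simp, by simp, h.1, h.2, ?_⟩
      rcases hcases with ⟨-, h1⟩ | ⟨-, h1⟩ | ⟨-, h0⟩ | ⟨-, h0⟩
      · exact h1
      · exact h1
      · omega
      · omega
    · have hw : w 0 ≤ i := by
        rcases hcases with ⟨h0, -⟩ | ⟨h0, -⟩ | ⟨-, h0⟩ | ⟨-, h0⟩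
        · by_contra hlt
          exact h ⟨by omega, by omega⟩
        · omega
        · omega
        · omega
      obtain ⟨a, b, ha, hb, he, ha0, hb0, hb1⟩ := ih hw hv
      exact ⟨a, b, by simp [ha], by simp [hb], by simp [he], ha0, hb0, hb1⟩

/-- In the two-row strip a vertex in column `i` is `(i,0)` or `(i,1)`. [folklore] -/
theorem eq_pt_or_eq_pt_of_mem_rectangle_one {m : ℕ} {z : Site 2}
    (hz : z ∈ (rectangle m 1 : Set (Site 2))) : z = pt (z 0) 0 ∨ z = pt (z 0) 1 := by
  simp only [Finset.mem_coe, mem_rectangle_iff] at hz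
  have h01 : z 1 = 0 ∨ z 1 = 1 := by omega
  rcases h01 with h | h
  · left; ext k; fin_cases k <;> simp [pt, h]
  · right; ext k; fin_cases k <;> simp [pt, h]

/-! ## §2 The two-cluster event at width 1 is the ladder configuration -/

/-- **Width 1: two distinct spanning clusters force the ladder configuration** (rows `0`, `1`
open, all `m+1` rungs closed), for lattice configurations. [folklore] -/
theorem twoClusterEvent_width_one_subset {m : ℕ} {ω : BondConfig (Site 2)}
    (hωE : ω ⊆ (zdGraph 2).edgeSet) (hω : ω ∈ twoClusterEvent m 1) : ω ∈ ladderEvent m := by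
  classical
  obtain ⟨x₁, hx₁, y₁, hy₁, x₂, hx₂, y₂, hy₂, h₁, h₂, h₁₂⟩ := hω
  obtain ⟨P₁, hS₁, hE₁⟩ := exists_walk_of_mem_openConnIn hωE h₁
  obtain ⟨P₂, hS₂, hE₂⟩ := exists_walk_of_mem_openConnIn hωE h₂
  -- a shared vertex merges the two clusters
  have key : ∀ z, z ∈ P₁.support → z ∈ P₂.support → False := fun z hz₁ hz₂ =>
    h₁₂ (PlanarDuality.openConnIn_trans (mem_openConnIn_of_mem_support P₁ hS₁ hE₁ hz₁)
      (by rw [openConnIn_comm]; exact mem_openConnIn_of_mem_support P₂ hS₂ hE₂ hz₂))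
  -- an open edge between the two walks merges the two clusters
  have key' : ∀ z₁ z₂, z₁ ∈ P₁.support → z₂ ∈ P₂.support → s(z₁, z₂) ∈ ω → False := by
    intro z₁ z₂ hz₁ hz₂ he
    by_cases hne : z₁ = z₂
    · subst hne; exact key z₁ hz₁ hz₂
    exact h₁₂ (PlanarDuality.openConnIn_trans
      (PlanarDuality.openConnIn_trans (mem_openConnIn_of_mem_support P₁ hS₁ hE₁ hz₁)
        (openConnIn_of_adj (hS₁ z₁ hz₁) (hS₂ z₂ hz₂) he hne))
      (by rw [openConnIn_comm]; exact mem_openConnIn_of_mem_support P₂ hS₂ hE₂ hz₂))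
  have hx₁0 : x₁ 0 = 0 := (Finset.mem_filter.1 (Finset.mem_coe.1 hx₁)).2
  have hx₂0 : x₂ 0 = 0 := (Finset.mem_filter.1 (Finset.mem_coe.1 hx₂)).2
  have hy₁0 : y₁ 0 = m := (Finset.mem_filter.1 (Finset.mem_coe.1 hy₁)).2
  have hy₂0 : y₂ 0 = m := (Finset.mem_filter.1 (Finset.mem_coe.1 hy₂)).2
  refine ⟨?_, ?_⟩
  · -- the two rows are open
    intro e he
    simp only [ladderRows, bottomRowEdges, rowOneEdges, Finset.coe_union, Finset.coe_image,
      Finset.coe_range, Set.mem_union, Set.mem_image, Set.mem_Iio] at he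
    -- e = s(pt i r, pt (i+1) r) with i < m, r ∈ {0, 1}
    obtain ⟨i, r, hi, hr, rfl⟩ : ∃ (i : ℕ) (r : ℤ), i < m ∧ (r = 0 ∨ r = 1) ∧
        s(pt i r, pt (i + 1) r) = e := by
      rcases he with ⟨i, hi, rfl⟩ | ⟨i, hi, rfl⟩
      · exact ⟨i, 0, hi, Or.inl rfl, rfl⟩
      · exact ⟨i, 1, hi, Or.inr rfl, rfl⟩
    by_contra heω
    obtain ⟨a, b, ha, hb, hab, ha0, hb0, hb1⟩ := exists_step_across P₁ i (by omega) (by omega)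
    obtain ⟨a', b', ha', hb', hab', ha0', hb0', hb1'⟩ := exists_step_across P₂ i (by omega) (by omega)
    -- a step across column `i` along an open edge runs in the other row `1 - r`
    have row_of_step : ∀ {c d : Site 2}, c ∈ (rectangle m 1 : Set (Site 2)) → c 0 = i →
        d 0 = i + 1 → d 1 = c 1 → s(c, d) ∈ ω → c = pt i (1 - r) := by
      intro c d hcR hc0 hd0 hd1 hcd
      simp only [Finset.mem_coe, mem_rectangle_iff] at hcR
      have hc1 : c 1 ≠ r := by
        intro h
        apply heω
        have hc : c = pt i r := by ext k; fin_cases k <;> simp [pt, hc0, h]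
        have hd : d = pt (i + 1) r := by ext k; fin_cases k <;> simp [pt, hd0, hd1, h]
        rw [← hc, ← hd]; exact hcd
      have hc1' : c 1 = 1 - r := by
        obtain ⟨-, -, h0, h1⟩ := hcR
        rcases hr with rfl | rfl <;> omega
      ext k; fin_cases k
      · simp [pt, hc0]
      · simp [pt, hc1']
    have hae : a = pt i (1 - r) := row_of_step (hS₁ a ha) ha0 hb0 hb1 (hE₁ _ hab)
    have hae' : a' = pt i (1 - r) := row_of_step (hS₂ a' ha') ha0' hb0' hb1' (hE₂ _ hab')
    exact key a ha (by rw [hae, ← hae']; exact ha')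
  · -- the rungs are closed
    intro e he heω
    simp only [rungEdges, Finset.mem_image, Finset.mem_range] at he
    obtain ⟨i, hi, rfl⟩ := he
    obtain ⟨z₁, hz₁, hz₁0⟩ := exists_mem_support_apply_eq P₁ 0 i (by omega) (by omega)
    obtain ⟨z₂, hz₂, hz₂0⟩ := exists_mem_support_apply_eq P₂ 0 i (by omega) (by omega)
    rcases eq_pt_or_eq_pt_of_mem_rectangle_one (hS₁ z₁ hz₁) with h1 | h1 <;>
      rcases eq_pt_or_eq_pt_of_mem_rectangle_one (hS₂ z₂ hz₂) with h2 | h2 <;>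
      rw [hz₁0] at h1 <;> rw [hz₂0] at h2
    · exact key z₁ hz₁ (by rw [h1, ← h2]; exact hz₂)
    · exact key' z₁ z₂ hz₁ hz₂ (by rw [h1, h2]; exact heω)
    · exact key' z₁ z₂ hz₁ hz₂ (by rw [h1, h2, Sym2.eq_swap]; exact heω)
    · exact key z₁ hz₁ (by rw [h1, ← h2]; exact hz₂)


/-! ## §3 The exact probability of the ladder configuration -/

/-- `i ↦ (i, j)` is injective on naturals. [folklore] -/
theorem pt_natCast_injective (j : ℤ) : Function.Injective fun i : ℕ => pt i j := by
  intro i i' h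
  have := congr_fun h 0
  simpa [pt] using this

/-- There are exactly `m + 1` rungs. [folklore] -/
theorem card_rungEdges (m : ℕ) : (rungEdges m).card = m + 1 := by
  rw [rungEdges, Finset.card_image_of_injective _ ?_, Finset.card_range]
  intro i i' h
  have h' := Sym2.eq_iff.1 h
  rcases h' with ⟨h0, -⟩ | ⟨h0, -⟩
  · exact pt_natCast_injective 0 h0
  · have := congr_fun h0 1; simp [pt] at this

/-- A row of `m` horizontal edges has exactly `m` edges. [folklore] -/
theorem card_image_rowEdges (m : ℕ) (j : ℤ) :
    ((Finset.range m).image fun i : ℕ => s(pt i j, pt (i + 1) j)).card = m := by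
  rw [Finset.card_image_of_injective _ ?_, Finset.card_range]
  intro i i' h
  have h' := Sym2.eq_iff.1 h
  rcases h' with ⟨h0, -⟩ | ⟨h0, h1⟩
  · exact pt_natCast_injective j h0
  · have e0 := congr_fun h0 0; have e1 := congr_fun h1 0
    simp [pt] at e0 e1; omega

/-- Rows `0` and `1` are disjoint edge sets. [folklore] -/
theorem disjoint_bottomRowEdges_rowOneEdges (m : ℕ) : Disjoint (bottomRowEdges m) (rowOneEdges m) := by
  rw [Finset.disjoint_left]
  intro e he he'
  simp only [bottomRowEdges, rowOneEdges, Finset.mem_image, Finset.mem_range] at he he'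
  obtain ⟨i, -, rfl⟩ := he
  obtain ⟨i', -, h⟩ := he'
  rcases Sym2.eq_iff.1 h with ⟨h0, -⟩ | ⟨h0, -⟩
  · have := congr_fun h0 1; simp [pt] at this
  · have := congr_fun h0 1; simp [pt] at this

/-- There are exactly `2m` row edges in the ladder. [folklore] -/
theorem card_ladderRows (m : ℕ) : (ladderRows m).card = 2 * m := by
  rw [ladderRows, Finset.card_union_of_disjoint (disjoint_bottomRowEdges_rowOneEdges m)]
  have h0 := card_image_rowEdges m 0
  have h1 := card_image_rowEdges m 1
  simp only [bottomRowEdges, rowOneEdges] at *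
  rw [h0, h1]; ring

/-- Rungs are lattice edges. [folklore] -/
theorem rungEdges_subset_edgeSet (m : ℕ) :
    (↑(rungEdges m) : Set (Sym2 (Site 2))) ⊆ (zdGraph 2).edgeSet := by
  intro e he
  simp only [rungEdges, Finset.coe_image, Finset.coe_range, Set.mem_image, Set.mem_Iio] at he
  obtain ⟨i, -, rfl⟩ := he
  rw [SimpleGraph.mem_edgeSet, zdGraph_adj_iff]
  refine ⟨1, Or.inl ?_⟩
  ext k; fin_cases k <;> simp [pt]

/-- **`P[ladder] = 2^{-(3m+1)}` exactly.** [folklore] -/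
theorem ladderEvent_eq (m : ℕ) :
    (bondPercolation (zdGraph 2) half).real (ladderEvent m) = (1 / 2 : ℝ) ^ (3 * m + 1) := by
  have hA := determinedBy_ladderRows m
  have hB := determinedBy_forall_notMem (V := Site 2) (rungEdges m)
  rw [ladderEvent, bondPercolation_real_inter_of_disjoint (zdGraph 2) half
    (disjoint_ladderRows_rungEdges m) hA hB hA.measurableSet_of_finset (measurableSet_forall_notMem _),
    bondPercolation_real_setOf_subset _ half _ (ladderRows_subset_edgeSet m),
    BGN.bondPercolation_real_forall_notMem_eq _ half _ (rungEdges_subset_edgeSet m), card_ladderRows,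
    card_rungEdges, coe_half]
  norm_num
  rw [← pow_add]; ring_nf

/-! ## §4 The exact width-1 two-cluster probability and rate -/

/-- **`p₂(m,1) ≤ 2^{-(3m+1)}`** (the two-cluster event is a.s. contained in the ladder event). [folklore] -/
theorem pTwo_width_one_le (m : ℕ) : pTwo m 1 ≤ (1 / 2 : ℝ) ^ (3 * m + 1) := by
  rw [← ladderEvent_eq]
  refine ENNReal.toReal_mono (measure_ne_top _ _) (measure_mono_ae ?_)
  filter_upwards [ae_subset_edgeSet (zdGraph 2) half] with ω hω h
  exact twoClusterEvent_width_one_subset hω h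

/-- **`p₂(m,1) = 2^{-(3m+1)}` exactly.** [folklore] -/
theorem pTwo_width_one (m : ℕ) : pTwo m 1 = (1 / 2 : ℝ) ^ (3 * m + 1) :=
  le_antisymm (pTwo_width_one_le m) (pTwo_ge le_rfl)

/-- The width-1 rate sequence in closed form: `-log p₂(m,1)/m = (3m+1) log 2 / m`. [folklore] -/
theorem rateSeqTwo_width_one (m : ℕ) : rateSeqTwo 1 m = (3 * m + 1 : ℝ) * Real.log 2 / m := by
  simp only [rateSeqTwo, pTwo_width_one, Real.log_pow, one_div, Real.log_inv]
  push_cast; ring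

/-- **The exact width-1 two-cluster rate: `γ₂(1) = 3 log 2 = log 8 = 2.0794…`.** [folklore] -/
theorem rateTwo_width_one : Tendsto (rateSeqTwo 1) atTop (𝓝 (3 * Real.log 2)) := by
  have h1 : Tendsto (fun m : ℕ ↦ 3 * Real.log 2 + Real.log 2 / (m : ℝ)) atTop
      (𝓝 (3 * Real.log 2 + 0)) :=
    tendsto_const_nhds.add (tendsto_const_nhds.div_atTop tendsto_natCast_atTop_atTop)
  rw [add_zero] at h1
  refine h1.congr' ?_
  filter_upwards [eventually_ge_atTop 1] with m hm
  rw [rateSeqTwo_width_one]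
  have : (m : ℝ) ≠ 0 := by exact_mod_cast Nat.one_le_iff_ne_zero.mp hm
  field_simp

/-- TIGHTNESS of `rateTwo_le` at `n = 1`: any limit of `-log p₂(m,1)/m` IS `3 log 2`. [folklore] -/
theorem rateTwo_width_one_unique {γ : ℝ} (h : Tendsto (rateSeqTwo 1) atTop (𝓝 γ)) :
    γ = 3 * Real.log 2 :=
  tendsto_nhds_unique h rateTwo_width_one

/-- In the language of the crux: every pair of rate functions `γ₁, γ₂` witnessing
`StripClusterRates` has `γ₂ 1 = 3 log 2` (so `1 · γ₂ 1 = 2.079… < 2π = 6.283…`: the approach to the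
Kac value `2π` starts strictly below it). [folklore] -/
theorem stripClusterRates_gammaTwo_one {γ₁ γ₂ : ℕ → ℝ}
    (h : (∀ n : ℕ, 1 ≤ n → Tendsto (rateSeqOne n) atTop (𝓝 (γ₁ n))) ∧
      (∀ n : ℕ, 1 ≤ n → Tendsto (rateSeqTwo n) atTop (𝓝 (γ₂ n))) ∧
      Tendsto (fun n : ℕ ↦ (n : ℝ) * γ₁ n) atTop (𝓝 (Real.pi / 3)) ∧
      Tendsto (fun n : ℕ ↦ (n : ℝ) * γ₂ n) atTop (𝓝 (2 * Real.pi))) :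
    γ₂ 1 = 3 * Real.log 2 :=
  rateTwo_width_one_unique (h.2.1 1 le_rfl)

end Summit.CriticalPhenomena.CardyFormulaZ2.Theorems.StripClusterRates.Negative
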